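import Summits.QuantumFields.YangMills.Theorems.LuscherReductionTwistedTraceScalingBOCentralSmearing
import HarnessLib

/-!
# THE CENTRAL QUASIMODE FROM THE TWO LAPLACE BRICKS: (C1) ⟸ (C1c) + (C1d), glued through (C1a) + (C1b)
# (lane A of S-BASE, crux `TwistedTraceScaling` stmt-QuantumFields-20203, C4-CORE, the (OD) pen; `pub/ym-fleet/ym-luscher-20007-p1/COARSE-DESIGN.md` §27.8–§27.9)

This file closes the loop of the (OD) reduction: the CENTRAL transfer `T₁(v') = fpFibreTransfer β Ω W (oT 1 v') 1` (the hypothesis `hC1` of `…BOCoreTransfer.colour_fpFibreTransfer_two_sided`)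
is sandwiched by `e^{∓η₀}·(brick constants)·P/I₀` as soon as the successor supplies the two Laplace bricks against PRODUCT HAAR:
* (C1c) a two-sided bound `m_c·G(V) ≤ A_W(χ₀⊗Ω)(V) ≤ M_c·G(V)` for the `W`-localised gauge average `A_W(χ₀⊗Ω)(V) = ∫_g W(g)·boFun χ₀ Ω (V^{g⁻¹}) dg` by some bounded measurable
  `G ≥ 0`-type comparison function (of record: `G(V) = N̄_W·χ₀(slowMean V)·e^{−q(P_⊥ relLinkVec V)}`, `m_c, M_c = 1 ∓ ε_c`);
* (C1d) a two-sided bound `m_d·P ≤ ∫_V K_β(oT 1 v', V)·G(V) dμ(V) ≤ M_d·P` (of record: `P = C_β e^{−q(x')}`, `m_d, M_d = 1 ∓ ε_d`).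
★★★ `central_transfer_two_sided_of_bricks`:  `e^{−η₀}·m_c m_d·P/I₀ ≤ T₁(v') ≤ e^{η₀}·M_c M_d·P/I₀`, `I₀ = ∫_u χ₀(u)K₁(1,u)/K₁(1,1) du > 0`,
`η₀ = coreEta L β 0 δu T R Γ σ + coreEps1 L β 0 T R + coreEps2 L β 0 T R σ` — by `central_transfer_smeared_two_sided` (C1a), `smeared_fpFibreTransfer_eq_localisedAvg` (C1b) and positivity of
`K_β`.  `two_sided_to_abs` converts any such sandwich `lo·P ≤ T ≤ hi·P` (`0 ≤ lo ≤ hi`, `P ≥ 0`) into the `|T − c₁P| ≤ η_c·c₁P` form of `hC1` (`c₁ = (lo+hi)/2`, `η_c = (hi−lo)/(hi+lo)`).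
HONEST FRAMING: glue only; (C1c), (C1d), tails, (B-ST) OPEN; C4-CORE OPEN; stub of a child of the CONDITIONAL route R2b1; not infinite volume, not a gap, not Clay.
-/

set_option autoImplicit false

noncomputable section

open MeasureTheory Filter Topology Real
open scoped BigOperators
open Literature.MathematicalPhysics.QuantumFieldTheory
open Literature.MathematicalPhysics.QuantumLattice

namespace Summit.QuantumFields.YangMills.Theorems.FemtoTransferGap.TwoLattice.ConstTube

open Summit.QuantumFields.YangMills.Theorems.FemtoTransferGap
open Summit.QuantumFields.YangMills.Theorems.FemtoTransferGap.TwoLattice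
open Summit.QuantumFields.YangMills.Theorems.FemtoTransferGap.TwoLattice.Avg
open Summit.QuantumFields.YangMills.Theorems.FemtoTransferGap.TwoLattice.Stiff (LinkSpace)

variable {L : ℕ} [NeZero L]

/-! ## §1 The localised gauge average of a BO function is bounded measurable -/

/-- `V ↦ A_W(χ₀⊗Ω)(V) = ∫_g W(g)·boFun χ₀ Ω (V^{g⁻¹}) dg` is measurable and bounded. [folklore] -/
theorem localisedAvg_boFun_props {Ω : LinkSpace L → ℝ} (hΩm : Measurable Ω) {CΩ : ℝ} (hCΩ : ∀ x, |Ω x| ≤ CΩ)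
    {W : (Site 3 L → SU2) → ℝ} (hW : Measurable W) {CW : ℝ} (hCW : ∀ g, |W g| ≤ CW)
    {χ₀ : GaugeConfig 3 1 SU2 → ℝ} (hχm : Measurable χ₀) {Cχ : ℝ} (hCχ : ∀ u, |χ₀ u| ≤ Cχ) :
    Measurable (fun V : GaugeConfig 3 L SU2 => ∫ g, W g * boFun L χ₀ Ω (gaugeTransform g⁻¹ V) ∂gaugeMeasure L) ∧
      ∀ V, |∫ g, W g * boFun L χ₀ Ω (gaugeTransform g⁻¹ V) ∂gaugeMeasure L| ≤ CW * (Cχ * CΩ) := by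
  haveI : IsProbabilityMeasure (gaugeMeasure L) := by unfold gaugeMeasure; infer_instance
  have hCW0 : 0 ≤ CW := (abs_nonneg _).trans (hCW 1)
  have hb : Measurable fun p : GaugeConfig 3 L SU2 × (Site 3 L → SU2) => W p.2 * boFun L χ₀ Ω (gaugeTransform p.2⁻¹ p.1) := by
    have h := (measurable_boFun L hχm hΩm).comp (measurable_gaugeAction_inv (L := L))
    exact (hW.comp measurable_snd).mul (by simpa only [Function.comp_def] using h)
  refine ⟨(hb.stronglyMeasurable.integral_prod_right' (ν := gaugeMeasure L)).measurable, fun V => ?_⟩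
  calc |∫ g, W g * boFun L χ₀ Ω (gaugeTransform g⁻¹ V) ∂gaugeMeasure L| ≤ ∫ g, |W g * boFun L χ₀ Ω (gaugeTransform g⁻¹ V)| ∂gaugeMeasure L := abs_integral_le_integral_abs
    _ ≤ ∫ _g, CW * (Cχ * CΩ) ∂gaugeMeasure L := integral_mono_of_nonneg (ae_of_all _ fun _ => abs_nonneg _) (integrable_const _) (ae_of_all _ fun g => by
        show |W g * boFun L χ₀ Ω (gaugeTransform g⁻¹ V)| ≤ CW * (Cχ * CΩ)
        rw [abs_mul]; exact mul_le_mul (hCW g) (abs_boFun_le L hCχ hCΩ _) (abs_nonneg _) hCW0)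
    _ = CW * (Cχ * CΩ) := by simp

/-! ## §2 From a sandwich to the `|T − c₁P| ≤ η_c c₁ P` form -/

/-- `lo·P ≤ T ≤ hi·P` with `0 ≤ lo ≤ hi`, `P ≥ 0` ⇒ `|T − ((lo+hi)/2)·P| ≤ ((hi−lo)/2)·P`. [folklore] -/
theorem two_sided_to_abs {T P lo hi : ℝ} (hlo : lo * P ≤ T) (hhi : T ≤ hi * P) : |T - (lo + hi) / 2 * P| ≤ (hi - lo) / 2 * P := by
  rw [abs_le]; constructor <;> linarith

/-! ## §3 ★★★ The central transfer from the two bricks -/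

/-- ★★★ **(C1) FROM (C1c) + (C1d).**  See the module docstring for the shape of the two brick hypotheses `hC1c`, `hC1d`. [cite: Luscher1983, §3] -/
theorem central_transfer_two_sided_of_bricks {β : ℝ} (hβ : 0 ≤ β) {Ω : LinkSpace L → ℝ} (hΩm : Measurable Ω) {CΩ : ℝ} (hCΩ : ∀ x, |Ω x| ≤ CΩ) (hΩ0 : ∀ x, 0 ≤ Ω x)
    {W : (Site 3 L → SU2) → ℝ} (hW : Measurable W) {CW : ℝ} (hCW : ∀ g, |W g| ≤ CW) (hW0 : ∀ g, 0 ≤ W g)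
    {δu T R Γ σ : ℝ} (hδu1 : δu ≤ 1) (hT : T ≤ 1 / 30) (hσ0 : 0 ≤ σ) (hσ : σ < 2)
    (hΩt : ∀ v : Edge 3 L → Fin 3 → ℝ, Ω (linkEmbed L v) ≠ 0 → v ∈ capBalancedSet L ∧ (∀ (e : Edge 3 L) (c : Fin 3), |v e c| ≤ T) ∧ ‖linkEmbed L v‖ ≤ R)
    (hWc : ∀ g : Site 3 L → SU2, W g ≠ 0 → (∀ x, ‖su2Quat (g x) - 1‖ ≤ T) ∧ ‖∑ x, vecPart (g x)‖ ≤ Γ)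
    {χ₀ : GaugeConfig 3 1 SU2 → ℝ} (hχm : Measurable χ₀) {Cχ : ℝ} (hCχ : ∀ u, |χ₀ u| ≤ Cχ) (hχ0 : ∀ u, 0 ≤ χ₀ u)
    (hχw : ∀ u, χ₀ u ≠ 0 → (∀ k : Fin 3, ‖su2Quat (u (0, k)) - 1‖ ≤ δu) ∧ (L : ℝ) ^ 3 * wilsonAction su2Rep u ≤ σ)
    (hI0 : 0 < ∫ u, χ₀ u * (transferKernel su2Rep ((L : ℝ) ^ 3 * β) (1 : GaugeConfig 3 1 SU2) u / transferKernel su2Rep ((L : ℝ) ^ 3 * β) (1 : GaugeConfig 3 1 SU2) 1)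
      ∂configMeasure SU2 1)
    {v' : Edge 3 L → Fin 3 → ℝ} (hv' : v' ∈ capBalancedSet L) (hv'T : ∀ (e : Edge 3 L) (c : Fin 3), |v' e c| ≤ T) (hx' : ‖linkEmbed L v'‖ ≤ R)
    -- the bricks
    {G : GaugeConfig 3 L SU2 → ℝ} (hGm : Measurable G) {CG : ℝ} (hCG : ∀ V, |G V| ≤ CG) {mc Mc : ℝ} (hmc : 0 ≤ mc) (hMc : 0 ≤ Mc)
    (hC1c : ∀ V : GaugeConfig 3 L SU2, mc * G V ≤ ∫ g, W g * boFun L χ₀ Ω (gaugeTransform g⁻¹ V) ∂gaugeMeasure L ∧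
      ∫ g, W g * boFun L χ₀ Ω (gaugeTransform g⁻¹ V) ∂gaugeMeasure L ≤ Mc * G V)
    {P md Md : ℝ}
    (hC1d : md * P ≤ ∫ V, transferKernel su2Rep β (orthoTube L 1 v') V * G V ∂configMeasure SU2 L ∧
      ∫ V, transferKernel su2Rep β (orthoTube L 1 v') V * G V ∂configMeasure SU2 L ≤ Md * P) :
    Real.exp (-(coreEta L β 0 δu T R Γ σ + coreEps1 L β 0 T R + coreEps2 L β 0 T R σ)) * (mc * md * P) /
          (∫ u, χ₀ u * (transferKernel su2Rep ((L : ℝ) ^ 3 * β) (1 : GaugeConfig 3 1 SU2) u / transferKernel su2Rep ((L : ℝ) ^ 3 * β) (1 : GaugeConfig 3 1 SU2) 1)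
            ∂configMeasure SU2 1) ≤ fpFibreTransfer L β Ω W (orthoTube L 1 v') 1 ∧
      fpFibreTransfer L β Ω W (orthoTube L 1 v') 1 ≤
        Real.exp (coreEta L β 0 δu T R Γ σ + coreEps1 L β 0 T R + coreEps2 L β 0 T R σ) * (Mc * Md * P) /
          (∫ u, χ₀ u * (transferKernel su2Rep ((L : ℝ) ^ 3 * β) (1 : GaugeConfig 3 1 SU2) u / transferKernel su2Rep ((L : ℝ) ^ 3 * β) (1 : GaugeConfig 3 1 SU2) 1)
            ∂configMeasure SU2 1) := by
  set η : ℝ := coreEta L β 0 δu T R Γ σ + coreEps1 L β 0 T R + coreEps2 L β 0 T R σ with hη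
  set I₀ : ℝ := ∫ u, χ₀ u * (transferKernel su2Rep ((L : ℝ) ^ 3 * β) (1 : GaugeConfig 3 1 SU2) u / transferKernel su2Rep ((L : ℝ) ^ 3 * β) (1 : GaugeConfig 3 1 SU2) 1)
    ∂configMeasure SU2 1 with hI₀
  set T₁ : ℝ := fpFibreTransfer L β Ω W (orthoTube L 1 v') 1 with hT₁
  set U' : GaugeConfig 3 L SU2 := orthoTube L 1 v' with hU'
  set S : ℝ := ∫ u, χ₀ u * fpFibreTransfer L β Ω W U' u ∂configMeasure SU2 1 with hS
  set A : GaugeConfig 3 L SU2 → ℝ := fun V => ∫ g, W g * boFun L χ₀ Ω (gaugeTransform g⁻¹ V) ∂gaugeMeasure L with hA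
  -- (C1a)
  obtain ⟨hlo, hhi⟩ := central_transfer_smeared_two_sided hβ hΩm hCΩ hΩ0 hW hCW hW0 hδu1 hT hσ0 hσ hΩt hWc hχm hCχ hχ0 hχw hv' hv'T hx'
  rw [← hη, ← hU', ← hT₁, ← hI₀, ← hS] at hlo hhi
  -- (C1b)
  have hSeq : S = ∫ V, transferKernel su2Rep β U' V * A V ∂configMeasure SU2 L := by
    rw [hS, hA]; exact smeared_fpFibreTransfer_eq_localisedAvg β hΩm hCΩ hW hCW hχm hCχ U'
  -- integrability of `K·A` and `K·G`
  obtain ⟨M, hM⟩ := exists_transferKernel_le su2Rep continuous_su2Rep β (L := L)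
  have hM0 : 0 ≤ M := (transferKernel_pos su2Rep β (1 : GaugeConfig 3 L SU2) 1).le.trans (hM 1 1)
  obtain ⟨hAm, hAb⟩ := localisedAvg_boFun_props hΩm hCΩ hW hCW hχm hCχ
  have hKm : Measurable fun V => transferKernel su2Rep β U' V := measurable_transferKernel_left β U'
  have iKA : Integrable (fun V => transferKernel su2Rep β U' V * A V) (configMeasure SU2 L) :=
    integrable_of_measurable_abs_le _ (hKm.mul hAm) (C := M * (CW * (Cχ * CΩ))) fun V => by
      rw [abs_mul, abs_of_pos (transferKernel_pos su2Rep β _ _)]; exact mul_le_mul (hM _ _) (hAb V) (abs_nonneg _) hM0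
  have iKG : Integrable (fun V => transferKernel su2Rep β U' V * G V) (configMeasure SU2 L) :=
    integrable_of_measurable_abs_le _ (hKm.mul hGm) (C := M * CG) fun V => by
      rw [abs_mul, abs_of_pos (transferKernel_pos su2Rep β _ _)]; exact mul_le_mul (hM _ _) (hCG V) (abs_nonneg _) hM0
  -- (C1c) integrated against the positive kernel
  have hSlo : mc * (md * P) ≤ S := by
    have h1 : mc * ∫ V, transferKernel su2Rep β U' V * G V ∂configMeasure SU2 L ≤ S := by
      rw [hSeq, ← integral_const_mul]
      refine integral_mono (iKG.const_mul mc) iKA fun V => ?_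
      dsimp only
      have := mul_le_mul_of_nonneg_left (hC1c V).1 (transferKernel_pos su2Rep β U' V).le
      linarith [this]
    exact le_trans (mul_le_mul_of_nonneg_left hC1d.1 hmc) h1
  have hShi : S ≤ Mc * (Md * P) := by
    have h1 : S ≤ Mc * ∫ V, transferKernel su2Rep β U' V * G V ∂configMeasure SU2 L := by
      rw [hSeq, ← integral_const_mul]
      refine integral_mono iKA (iKG.const_mul Mc) fun V => ?_
      dsimp only
      have := mul_le_mul_of_nonneg_left (hC1c V).2 (transferKernel_pos su2Rep β U' V).le
      linarith [this]
    exact h1.trans (mul_le_mul_of_nonneg_left hC1d.2 hMc)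
  -- solve for `T₁`
  have hexp : Real.exp (-η) * Real.exp η = 1 := by rw [← Real.exp_add]; simp
  constructor
  · rw [div_le_iff₀ hI0]
    calc Real.exp (-η) * (mc * md * P) = Real.exp (-η) * (mc * (md * P)) := by ring
      _ ≤ Real.exp (-η) * S := mul_le_mul_of_nonneg_left hSlo (Real.exp_pos _).le
      _ ≤ Real.exp (-η) * (Real.exp η * T₁ * I₀) := mul_le_mul_of_nonneg_left hhi (Real.exp_pos _).le
      _ = T₁ * I₀ := by rw [← mul_assoc, ← mul_assoc, hexp, one_mul]
  · rw [le_div_iff₀ hI0]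
    calc T₁ * I₀ = Real.exp η * (Real.exp (-η) * T₁ * I₀) := by
          rw [← mul_assoc, ← mul_assoc, mul_comm (Real.exp η), hexp, one_mul]
      _ ≤ Real.exp η * S := mul_le_mul_of_nonneg_left hlo (Real.exp_pos _).le
      _ ≤ Real.exp η * (Mc * (Md * P)) := mul_le_mul_of_nonneg_left hShi (Real.exp_pos _).le
      _ = Real.exp η * (Mc * Md * P) := by ring

end Summit.QuantumFields.YangMills.Theorems.FemtoTransferGap.TwoLattice.ConstTube

end
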